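import Summits.QuantumFields.GaugeBoot.TiltedBoxLimitGeometry
import Summits.QuantumFields.GaugeBoot.TiltedBoxOddAxisGeometry
import Summits.QuantumFields.GaugeBoot.TiltedLinkRPGeometry
import HarnessLib

/-!
# Infinite-volume limit points of the 45°-tilted boxes, part 15: in-plane half-spaces and mirrors under the lift

HONEST FRAMING (cell `pub-gaugeboot`, page 1 of every file): the venture produces certified bounds
on lattice expectations at stated coupling, gauge group, dimension and torus size; NOT a mass gap,
NOT a continuum limit, NOT a string tension; NOT Yang–Mills-summit-bearing (barriers
`FixedCouplingUltralocality`, `PerturbativeInvisibility`). Pure bookkeeping (no measure occurs) for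
the sequel `TiltedBoxLimitInPlaneRP.lean`.

## Content

`TiltedBoxLimitGeometry.lean` relates the `Γ`-periodic lift `tiltedLift` to the TRANSVERSE mirrors
(`k ∉ {i, j}`) and to the diagonal one. Here the same is done for the IN-PLANE axis `i` of the SQUARE
box `ℤ^d/Γ(M, M, L)` (the flip `tiltedAxisFlip`, a symmetry of `Γ` only for `M_u = M_v`):

* `tiltedLift_configReflect_axis` — `tiltedLift (configReflect _ i (tiltedAxisFlip …) U) = configSiteReflect i (tiltedLift U)`;
* `tiltedLift_configMidReflect_axis` — `tiltedLift (configMidReflect _ i (tiltedAxisFlip …) U) = configLinkReflect i (tiltedLift U)`;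
* `val_axisCoord_mk` — the coordinate `x_i mod M` of the class of a site with `0 ≤ x_i < M` is `x_i`;
* `isHalfObservable_axis_comp_tiltedLift` — a cylinder observable of `ℤ^d` supported on links of
  `{x_i ≥ 0}` with `x_i ≤ m` on its support, read through the lift, is an observable of the closed
  half `{0 ≤ x_i ≤ P}` (`IsHalfObservable … (2P+1) (axisHeight2 …)`) of every ODD box `M = 2P + 1`
  with `P ≥ m + 1`;
* `isMidObservable_axis_comp_tiltedLift` — one supported on links of `{x_i ≥ 1}` with `x_i ≤ m` is an
  observable of the closed half `{1 ≤ x_i ≤ P}` (`IsMidObservable … P (axisCoord …)`) of every EVEN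
  box `M = 2P` with `P ≥ m + 1`;
* conjugation by the axis swap `(i j)`: `configPerm_swap_configPerm_swap'`,
  `configSiteReflect_eq_conj_swap`, `configLinkReflect_eq_conj_swap`,
  `dependsOn_comp_configPerm_swap_siteHalf`, `dependsOn_comp_configPerm_swap_linkHalf` — to carry
  reflection positivity along `i` to the axis `j` by `IsReflectionPositiveFor.of_conj`.

References: K. Osterwalder, E. Seiler, Ann. Phys. 110 (1978) 440, §2 (the half-space bookkeeping).
-/

noncomputable section

open Literature.Probability.LatticeModels (Site)
open Literature.MathematicalPhysics.QuantumLattice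

namespace Summit.QuantumFields.GaugeBoot

namespace TiltedRP

/-! ## The in-plane mirrors under the lift -/

section Intertwiners

variable (d : ℕ) {i j : Fin d} (M L : ℕ) {G : Type*} [Group G]

/-- **The in-plane axis flip** (square box): `tiltedLift (configReflect _ i (tiltedAxisFlip …) U) =
configSiteReflect i (tiltedLift U)`. -/
theorem tiltedLift_configReflect_axis (hij : i ≠ j) (U : Config (TiltedSite d i j M M L) d G) :
    tiltedLift d i j M M L (configReflect (tiltedUnit d i j M M L) i (tiltedAxisFlip d L M hij) U) =
      configSiteReflect i (tiltedLift d i j M M L U) :=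
  tiltedLift_configReflect_flip d i j M M L i (tiltedLattice_le_comap_negHom_left d L hij) U

/-- **The in-plane link mirror** (square box): `tiltedLift (configMidReflect _ i (tiltedAxisFlip …) U)
= configLinkReflect i (tiltedLift U)`. -/
theorem tiltedLift_configMidReflect_axis (hij : i ≠ j) (U : Config (TiltedSite d i j M M L) d G) :
    tiltedLift d i j M M L (configMidReflect (tiltedUnit d i j M M L) i (tiltedAxisFlip d L M hij) U) =
      configLinkReflect i (tiltedLift d i j M M L U) := by
  funext e
  obtain ⟨x, l⟩ := e
  have hmid : midReflect (tiltedUnit d i j M M L) i (tiltedAxisFlip d L M hij)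
      (x : TiltedSite d i j M M L) = ((zdLinkReflect i x : Site d) : TiltedSite d i j M M L) := by
    rw [midReflect, tiltedAxisFlip_mk, ← negHom_add_single_eq_zdLinkReflect, mk_add_single]
  simp only [tiltedLift_apply, configMidReflect, midLinkMap, configLinkReflect_apply, hmid]
  by_cases hl : l = i
  · subst hl
    simp only [if_true, ← sub_eq_add_neg, mk_sub_single]
  · simp only [if_neg hl, add_zero]

end Intertwiners

/-! ## In-plane half-spaces lift to the halves of large square boxes -/

section Halves

variable {d : ℕ} {i j : Fin d} {L : ℕ} {G α : Type*}

/-- The coordinate `x_i mod M` of the class of a site with `0 ≤ x_i < M`, read in `[0, M)`, is `x_i`. -/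
theorem val_axisCoord_mk {M : ℕ} [NeZero M] {x : Site d} (h0 : 0 ≤ x i) (hlt : x i < M) :
    ((axisCoord d L M (x : TiltedSite d i j M M L)).val : ℤ) = x i := by
  rw [axisCoord_mk, ZMod.val_intCast]
  exact Int.emod_eq_of_lt h0 hlt

/-- **Site half along the in-plane axis `i`, odd box.** A cylinder observable supported on links `T`
of the closed half `{x_i ≥ 0}` (`siteHalfEdges i`) with `x_i ≤ m` on `T`, read through the lift, is
an observable of the closed half `{0 ≤ x_i ≤ P}` of every odd square box `M = 2P + 1` with
`P ≥ m + 1`. -/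
theorem isHalfObservable_axis_comp_tiltedLift {P : ℕ} {F : LGConfig d G → α}
    {T : Finset (ZdEdge d)} (hF : IsCylinder F T) (hT : ∀ e ∈ T, e ∈ siteHalfEdges i) {m : ℕ}
    (hTm : ∀ e ∈ T, e.1 i ≤ m) (hP : m + 1 ≤ P) :
    IsHalfObservable (tiltedUnit d i j (2 * P + 1) (2 * P + 1) L) (2 * P + 1)
      (axisHeight2 d L (2 * P + 1)) (fun U => F (tiltedLift d i j (2 * P + 1) (2 * P + 1) L U)) := by
  intro U V hUV
  refine hF fun e he => ?_
  simp only [tiltedLift_apply]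
  have hmem : 0 ≤ e.1 i := hT e he
  have hm := hTm e he
  refine hUV _ ⟨?_, ?_⟩
  · show InHalf (2 * P + 1) (axisHeight2 d L (2 * P + 1))
      (e.1 : TiltedSite d i j (2 * P + 1) (2 * P + 1) L)
    rw [inHalf_iff]
    have h := val_axisCoord_mk (L := L) (j := j) (M := 2 * P + 1) (x := e.1) hmem
      (by push_cast; omega)
    omega
  · show InHalf (2 * P + 1) (axisHeight2 d L (2 * P + 1))
      ((e.1 : TiltedSite d i j (2 * P + 1) (2 * P + 1) L) + tiltedUnit d i j (2 * P + 1) (2 * P + 1) L e.2)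
    rw [← mk_add_single, inHalf_iff]
    obtain ⟨h0, h1⟩ := coord_endpoint_bounds (k := i) hmem hm
    have h := val_axisCoord_mk (L := L) (j := j) (M := 2 * P + 1) h0 (by push_cast; omega)
    omega

/-- **Link half along the in-plane axis `i`, even box.** A cylinder observable supported on links `T`
of the closed half `{x_i ≥ 1}` (`linkHalfEdges i`) with `x_i ≤ m` on `T`, read through the lift, is
an observable of the closed half `{1 ≤ x_i ≤ P}` of the link mirror of every even square box
`M = 2P` with `P ≥ m + 1`. -/
theorem isMidObservable_axis_comp_tiltedLift {P : ℕ} [NeZero P] {F : LGConfig d G → α}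
    {T : Finset (ZdEdge d)} (hF : IsCylinder F T) (hT : ∀ e ∈ T, e ∈ linkHalfEdges i) {m : ℕ}
    (hTm : ∀ e ∈ T, e.1 i ≤ m) (hP : m + 1 ≤ P) :
    IsMidObservable (tiltedUnit d i j (2 * P) (2 * P) L) P (axisCoord d L (2 * P))
      (fun U => F (tiltedLift d i j (2 * P) (2 * P) L U)) := by
  haveI : NeZero (2 * P) := ⟨by have := NeZero.ne P; omega⟩
  intro U V hUV
  refine hF fun e he => ?_
  simp only [tiltedLift_apply]
  have hmem : 1 ≤ e.1 i := hT e he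
  have hm := hTm e he
  refine hUV _ ⟨?_, ?_⟩
  · show 1 ≤ (axisCoord d L (2 * P) (e.1 : TiltedSite d i j (2 * P) (2 * P) L)).val ∧
      (axisCoord d L (2 * P) (e.1 : TiltedSite d i j (2 * P) (2 * P) L)).val ≤ P
    have h := val_axisCoord_mk (L := L) (i := i) (j := j) (M := 2 * P) (x := e.1) (by omega)
      (by push_cast; omega)
    constructor <;> omega
  · show 1 ≤ (axisCoord d L (2 * P)
        ((e.1 : TiltedSite d i j (2 * P) (2 * P) L) + tiltedUnit d i j (2 * P) (2 * P) L e.2)).val ∧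
      (axisCoord d L (2 * P)
        ((e.1 : TiltedSite d i j (2 * P) (2 * P) L) + tiltedUnit d i j (2 * P) (2 * P) L e.2)).val ≤ P
    rw [← mk_add_single]
    obtain ⟨h0, h1⟩ := coord_endpoint_bounds (k := i) (e := e) (by omega) hm
    have h1' : 1 ≤ (e.1 + Pi.single e.2 (1 : ℤ) : Site d) i := by
      simp only [Pi.add_apply, Pi.single_apply]
      split_ifs <;> omega
    have h := val_axisCoord_mk (L := L) (j := j) (M := 2 * P) h0 (by push_cast; omega)
    constructor <;> omega

end Halves

/-! ## Conjugating the mirrors of the axis `j` to those of the axis `i` by the swap `(i j)` -/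

section Swap

variable {d : ℕ} (i j : Fin d) {G : Type*}

/-- The axis swap `(i j)` acts as an involution on configurations. -/
theorem configPerm_swap_configPerm_swap' (U : LGConfig d G) :
    configPerm (Equiv.swap i j) (configPerm (Equiv.swap i j) U) = U := by
  funext e
  simp only [configPerm, Equiv.symm_swap, Equiv.swap_apply_self]
  congr 1
  ext1
  · funext m; simp [Equiv.swap_apply_self]
  · rfl

variable [Group G]

/-- **The site reflection along `j` is conjugate to the one along `i` by `(i j)`.** -/
theorem configSiteReflect_eq_conj_swap (U : LGConfig d G) :
    configSiteReflect j U =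
      configPerm (Equiv.swap i j) (configSiteReflect i (configPerm (Equiv.swap i j) U)) := by
  set σ : Equiv.Perm (Fin d) := Equiv.swap i j with hσ
  funext e
  obtain ⟨x, k⟩ := e
  have key : ∀ c : ℤ, ((zdSiteReflect i (x ∘ ⇑σ) - Pi.single i c : Site d) ∘ ⇑σ) =
      (zdSiteReflect j x - Pi.single j c : Site d) := by
    intro c
    funext m
    simp only [hσ, Function.comp_apply, Pi.sub_apply, zdSiteReflect, Function.update_apply,
      Pi.single_apply, Equiv.swap_apply_eq_iff, Equiv.swap_apply_left, Equiv.swap_apply_self]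
  have k0 : (zdSiteReflect i (x ∘ ⇑σ) : Site d) ∘ ⇑σ = zdSiteReflect j x := by
    simpa using key 0
  simp only [configPerm, configSiteReflect_apply, hσ, Equiv.symm_swap, Equiv.swap_apply_self,
    Equiv.swap_apply_left, Equiv.swap_apply_eq_iff]
  by_cases hk : k = j
  · rw [if_pos hk, if_pos hk, ← hσ, key 1]
  · rw [if_neg hk, if_neg hk, ← hσ, k0]

/-- **The link reflection along `j` is conjugate to the one along `i` by `(i j)`.** -/
theorem configLinkReflect_eq_conj_swap (U : LGConfig d G) :
    configLinkReflect j U =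
      configPerm (Equiv.swap i j) (configLinkReflect i (configPerm (Equiv.swap i j) U)) := by
  set σ : Equiv.Perm (Fin d) := Equiv.swap i j with hσ
  funext e
  obtain ⟨x, k⟩ := e
  have key : ∀ c : ℤ, ((zdLinkReflect i (x ∘ ⇑σ) - Pi.single i c : Site d) ∘ ⇑σ) =
      (zdLinkReflect j x - Pi.single j c : Site d) := by
    intro c
    funext m
    simp only [hσ, Function.comp_apply, Pi.sub_apply, zdLinkReflect, Function.update_apply,
      Pi.single_apply, Equiv.swap_apply_eq_iff, Equiv.swap_apply_left, Equiv.swap_apply_self]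
  have k0 : (zdLinkReflect i (x ∘ ⇑σ) : Site d) ∘ ⇑σ = zdLinkReflect j x := by
    simpa using key 0
  simp only [configPerm, configLinkReflect_apply, hσ, Equiv.symm_swap, Equiv.swap_apply_self,
    Equiv.swap_apply_left, Equiv.swap_apply_eq_iff]
  by_cases hk : k = j
  · rw [if_pos hk, if_pos hk, ← hσ, key 1]
  · rw [if_neg hk, if_neg hk, ← hσ, k0]

omit [Group G] in
/-- Observables of the site half `{x_j ≥ 0}` pull back under `(i j)` to observables of `{x_i ≥ 0}`. -/
theorem dependsOn_comp_configPerm_swap_siteHalf (F : LGConfig d G → ℂ)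
    (hF : DependsOn F (siteHalfEdges j)) :
    DependsOn (F ∘ configPerm (Equiv.swap i j)) (siteHalfEdges i) := by
  intro U V hUV
  simp only [Function.comp_apply]
  apply hF
  intro e he
  simp only [configPerm, Equiv.symm_swap]
  apply hUV
  show (0 : ℤ) ≤ (e.1 ∘ ⇑(Equiv.swap i j)) i
  have he' : (0 : ℤ) ≤ e.1 j := he
  simpa [Equiv.swap_apply_left] using he'

omit [Group G] in
/-- Observables of the link half `{x_j ≥ 1}` pull back under `(i j)` to observables of `{x_i ≥ 1}`. -/
theorem dependsOn_comp_configPerm_swap_linkHalf (F : LGConfig d G → ℂ)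
    (hF : DependsOn F (linkHalfEdges j)) :
    DependsOn (F ∘ configPerm (Equiv.swap i j)) (linkHalfEdges i) := by
  intro U V hUV
  simp only [Function.comp_apply]
  apply hF
  intro e he
  simp only [configPerm, Equiv.symm_swap]
  apply hUV
  show (1 : ℤ) ≤ (e.1 ∘ ⇑(Equiv.swap i j)) i
  have he' : (1 : ℤ) ≤ e.1 j := he
  simpa [Equiv.swap_apply_left] using he'

end Swap

end TiltedRP

end Summit.QuantumFields.GaugeBoot
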